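import Summits.QuantumFields.BalabanUV.Beta.GAN24.RowV0Table
import Summits.QuantumFields.BalabanUV.Beta.GAN24.E3UnitSplitSum
import Summits.QuantumFields.BalabanUV.Beta.GAN24.TaylorVHSandwich
import Summits.QuantumFields.BalabanUV.Beta.GAN24.StencilSlotE3PhiLeg
import Summits.QuantumFields.BalabanUV.Beta.GAN24.StencilSlotE3HLeg

/-!
# `BalabanUV.Beta.GAN24.S3RowV0` — binder row G-an2-4 / (CONV-C), S-slot, road «S3-Taylor» (PART III of `GAN24/Formal/LEAVES.md` v3.2, row S3-V0;
# `SKELETON-S3.md` v1.1 §12.2∕§16): **SHAPE ROW V0, UNCONDITIONAL** — the level-0 (V-H) piece of `S₀` pushed `n+1` times is `LocStencil`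
# with constant `c₀V·(Lc⁻¹)^{n+1}`, ONE `(c₀V, δ)` for all members (`d = 3`, every `Lc ≥ 1`)

Statement copied from the staged END `StencilSlotE3OfPieces` 2cc3c5eb8d83de1a (hypothesis `hV0` of `e3Shape_of_pieces`, `d = 3`, `θ = Lc⁻¹`).
NOT IN PRINT; OUR PROOF (leaf seat `b2b-balaban-gan24-formalise-leaf-09` gen 15, holder of ROW-V0, journal INTENT l.4698).  HONEST FRAMING (cell
contract, verbatim): «discharging `BetaPertH` makes Bałaban's UV stability UNCONDITIONAL — a real constructive-QFT result; it is NOT the continuum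
limit and NOT the Clay problem.»  HONEST DEPENDENCY (verbatim): «continuum YM on T⁴ ⇐ BetaPertH ∧ nine spine estimates (0/9 proved); BetaPertH ⇐
(D1) ∧ (D4) ∧ CAP+tail; G-an2-4 gates asym, D1 and NE2/3/4.»  [folklore] assembly BY NAME of the ENGINES OF RECORD (owner RULINGS-9, journal
l.4834): leaf-01's template `E3UnitSplit.e3VH0_unit_split`, leaf-12's two-channel engine `TaylorVHSandwich.abs_twoChannel_le`, the owner's leg
modules `StencilSlotE3PhiLeg.phiLeg_three` (K-slot currency, road P1 inside) and `StencilSlotE3HLeg.legs_three` ((N1) `FineReadoutDecay` inside),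
and this seat's table facts `RowV0Table.table_suppR_*`∕`table_mass2_*` (VH1 inside).  Cites nothing, mints no `def`, instantiates no wall
binder.  This is ONE of the twelve analytic rows of `StencilSlotE3Tables.hS_hSall_of_rows`; it discharges NOTHING of the other eleven, of
«E3Shape»∕«E3SupRate», (hS, hSall); NOT BetaPertH, NOT continuum, NOT Clay.  (A second, engine-independent proof of the same statement on this
seat's `SandwichVH` is kept in records: `HOME/b2b-balaban-gan24-formalise-leaf-09/g15/rowv0/RowV0.v1.lean`, XREAD currency.)

## What is proved
§1 `leg_mono` (common constant∕rate for the five legs).  §2 **`shapeV0`** (`Lc ≥ 1`):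
`∃ c₀V δ, 0 ≤ c₀V ∧ 0 < δ ∧ ∀ n, LocStencil (fun κ′ u′ x′ z′ a b ↦ ((Lc:ℝ)^(n+1+1))^(2*(3+1)) * e3OfS (Lc^(n+1+1))
  (fun κ u ↦ ((((Lc:ℝ)^(3+1))^(n+1)) * cVH) • pushSum Lc (Lc^(n+1)) (mfNeg (vhS 3 Lc κ u))) κ′ u′ x′ z′ a b) (c₀V * ((Lc:ℝ)⁻¹)^(n+1)) δ`.
MECHANISM (§16, confirmed in the kernel): ABSOLUTE values — template prefactor `N^{−2}` × push multiplicity `Lc^{n+1}` in the two-leg mass × the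
`N`-free two-channel constant (support radius `R = 8(3+1)·N`, so `R/N = 32`) = `O(Lc^{−(n+1)})`; no cancellation.
-/

noncomputable section

open Finset Filter Topology
open scoped BigOperators
open Literature.MathematicalPhysics.QuantumFieldTheory
open Literature.MathematicalPhysics.QuantumFieldTheory.Balaban1983to89
open Literature.MathematicalPhysics.QuantumFieldTheory.Balaban1983to89.Beta
open B12Sec2to5 (l1 l1_nonneg)
open ExpKernelCalculus (MKer Zl Zl_nonneg l1_sub_symm)
open LatticeForm (quo)
open KernelSpecInstance (wH)
open KKTFluctuationKernel (GamΦ)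
open OneStepResolventKernel (Fib LocStencil KInv)
open StepJetData (mfNeg)
open AveragingHessianKernels (vhS ell)
open BalabanCompositeJets (pushSum)
open Summit.QuantumFields.BalabanUV.Beta.GAN24.E3UnitSplit (e3OfS e3VH0_unit_split e3OfS_inl_inr e3OfS_inr)
open Summit.QuantumFields.BalabanUV.Beta.GAN24.TaylorVHSandwich (abs_twoChannel_le)
open Summit.QuantumFields.BalabanUV.Beta.GAN24.StencilSlotE3PhiLeg (phiLeg_three)
open Summit.QuantumFields.BalabanUV.Beta.GAN24.StencilSlotE3HLeg (legs_three)
open Summit.QuantumFields.BalabanUV.Beta.GAN24.RowV0Table (table_suppR_mf table_suppR_fm table_mass2_mf table_mass2_fm)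

namespace Summit.QuantumFields.BalabanUV.Beta.GAN24.S3RowV0

variable {Lc : ℕ} [NeZero Lc]

/-! ## §1 One constant and one rate for all legs -/

omit [NeZero Lc] in
/-- [folklore] Weakening a leg bound `C·e^{−δ t}` (`t ≥ 0`) to a larger constant and a smaller rate. -/
theorem leg_mono {v C A δ κ t : ℝ} (h : |v| ≤ C * Real.exp (-δ * t)) (hC : C ≤ A) (hκ : κ ≤ δ) (ht : 0 ≤ t) (hC0 : 0 ≤ C) :
    |v| ≤ A * Real.exp (-κ * t) := by
  refine h.trans (mul_le_mul hC (Real.exp_le_exp.2 (by nlinarith)) (Real.exp_pos _).le (hC0.trans hC))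

/-! ## §2 ROW V0 -/

/-- **SHAPE ROW S3-V0 OF THE S3 TABLE, UNCONDITIONAL** (`d = 3`, `Lc ≥ 1`): the level-0 (V-H) piece of `S₀` pushed `n+1` times, read by the
normalised third-jet functional of member `n+2`, is a local stencil family with constant `c₀V·(Lc⁻¹)^{n+1}` — the hypothesis `hV0` of
`StencilSlotE3OfPieces.e3Shape_of_pieces` at `d = 3` with `θ = Lc⁻¹`.  Engines BY NAME: `e3VH0_unit_split`, `TaylorVHSandwich.abs_twoChannel_le`,
`StencilSlotE3PhiLeg.phiLeg_three`, `StencilSlotE3HLeg.legs_three`, `RowV0Table`. [folklore] -/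
theorem shapeV0 (hL : 1 ≤ Lc) (cVH : ℝ) :
    ∃ c₀V δ : ℝ, 0 ≤ c₀V ∧ 0 < δ ∧ ∀ n : ℕ,
      LocStencil (fun κ' u' x' z' a b => ((Lc : ℝ) ^ (n + 1 + 1)) ^ (2 * (3 + 1)) *
        e3OfS (Lc ^ (n + 1 + 1)) (fun κ u => ((((Lc : ℝ) ^ (3 + 1)) ^ (n + 1)) * cVH) • pushSum Lc (Lc ^ (n + 1)) (mfNeg (vhS 3 Lc κ u)))
          κ' u' x' z' a b) (c₀V * ((Lc : ℝ)⁻¹) ^ (n + 1)) δ := by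
  -- legs: one constant `A`, one rate `κ₁`
  obtain ⟨CΦ, δΦ, hδΦ, hCΦ, hΦrow, hΦcol⟩ := phiLeg_three (Lc := Lc)
  obtain ⟨CH, κH, hκH, hCH, hHleg, hGleg⟩ := legs_three (Lc := Lc)
  set A : ℝ := max CΦ CH with hA
  have hA0 : 0 ≤ A := hCΦ.trans (le_max_left _ _)
  set κ₁ : ℝ := min δΦ κH with hκ₁
  have hκ₁pos : 0 < κ₁ := lt_min hδΦ hκH
  have hL0 : (0 : ℝ) < Lc := by exact_mod_cast (show 0 < Lc by omega)
  -- the n-free table mass unit and the sandwich constant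
  set B₂ : ℝ := (((2 * (2 * (3 + 1) * Lc) + 1 : ℕ) : ℝ) ^ (3 + 1) *
      (((2 * (2 * (3 + 1) * Lc) + 1 : ℕ) : ℝ) ^ (3 + 1) * (3 * (ell (3 + 1) Lc : ℝ) ^ 2))) with hB₂
  have hB₂0 : 0 ≤ B₂ := by positivity
  have hZ : 0 ≤ Zl (3 + 1) (κ₁ / 2) := Zl_nonneg (by positivity)
  set K : ℝ := 2 * ((Fintype.card (Fin (3 + 1)) : ℝ) ^ 3 * A ^ 3 * Real.exp (κ₁ * (4 * (3 + 1) * (8 * (3 + 1)) + 2 * (3 + 1))) * B₂ *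
      Zl (3 + 1) (κ₁ / 2)) with hK
  have hK0 : 0 ≤ K := by positivity
  set c₀V : ℝ := |cVH| / (Lc : ℝ) ^ (3 + 1) * ((Lc : ℝ) ^ 2)⁻¹ * K with hc₀V
  have hc₀V0 : 0 ≤ c₀V := by positivity
  refine ⟨c₀V, κ₁ / 2, hc₀V0, by positivity, fun n => ?_⟩
  intro κ' u' x' z' a b
  dsimp only
  have hRHS : 0 ≤ c₀V * ((Lc : ℝ)⁻¹) ^ (n + 1) * Real.exp (-(κ₁ / 2) * (l1 (x' - u') + l1 (z' - u'))) := by positivity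
  rcases a with α | μ
  · rcases b with β | ν
    · -- the field–field block: the two-channel template
      rw [e3VH0_unit_split (Lc := Lc) (d := 3) cVH (n + 1) (n + 1 + 1) rfl κ' u' x' z' α β]
      have ecast : (((Lc ^ (n + 1 + 1) : ℕ) : ℝ)) = (Lc : ℝ) ^ (n + 1 + 1) := by push_cast; ring
      have hmP : 0 ≤ (Lc : ℝ) ^ (n + 1) * B₂ := mul_nonneg (pow_nonneg hL0.le _) hB₂0
      haveI : NeZero (Lc ^ (n + 1 + 1)) := ⟨pow_ne_zero _ (NeZero.ne Lc)⟩
      have h2 := abs_twoChannel_le (N := Lc ^ (n + 1 + 1)) (ι := Fin (3 + 1))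
        (fun w l => ((Lc : ℝ) ^ (n + 1 + 1)) ^ (2 * (3 + 1)) *
          KInv (N := Lc ^ (n + 1 + 1)) (d := 3) (((Lc ^ (n + 1 + 1) : ℕ) : ℤ) • x') w (Sum.inr α) (Sum.inr l))
        (fun w l => ((Lc : ℝ) ^ (n + 1 + 1)) ^ (3 + 2) * GamΦ (N := Lc ^ (n + 1 + 1)) α x' l w)
        (fun k u => ((Lc : ℝ) ^ (n + 1 + 1)) ^ (3 + 2) * wH (N := Lc ^ (n + 1 + 1)) k κ' (u - ((Lc ^ (n + 1 + 1) : ℕ) : ℤ) • u'))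
        (fun y l' => ((Lc : ℝ) ^ (n + 1 + 1)) ^ (3 + 2) * wH (N := Lc ^ (n + 1 + 1)) l' β (y - ((Lc ^ (n + 1 + 1) : ℕ) : ℤ) • z'))
        (fun y l' => ((Lc : ℝ) ^ (n + 1 + 1)) ^ (2 * (3 + 1)) *
          KInv (N := Lc ^ (n + 1 + 1)) (d := 3) y (((Lc ^ (n + 1 + 1) : ℕ) : ℤ) • z') (Sum.inr l') (Sum.inr β))
        (fun k u w y l l' => pushSum Lc (Lc ^ (n + 1)) (mfNeg (vhS 3 Lc k u)) w y (Sum.inr l) (Sum.inl l'))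
        (fun k u w y l l' => pushSum Lc (Lc ^ (n + 1)) (mfNeg (vhS 3 Lc k u)) w y (Sum.inl l) (Sum.inr l'))
        (x' := x') (u' := u') (z' := z') (A := A) (κ := κ₁) (mP := (Lc : ℝ) ^ (n + 1) * B₂) (R := 8 * (3 + 1) * Lc ^ (n + 1 + 1))
        hκ₁pos hA0 hmP
        (fun w l => leg_mono (hΦrow (n + 1) x' w α l) (le_max_left _ _) (min_le_left _ _) (l1_nonneg _) hCΦ)
        (fun w l => by
          have h := hGleg (n + 1) α l x' w
          rw [l1_sub_symm] at h
          exact leg_mono h (le_max_right _ _) (min_le_right _ _) (l1_nonneg _) hCH)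
        (fun k u => leg_mono (hHleg (n + 1) k κ' u u') (le_max_right _ _) (min_le_right _ _) (l1_nonneg _) hCH)
        (fun y l' => leg_mono (hHleg (n + 1) l' β y z') (le_max_right _ _) (min_le_right _ _) (l1_nonneg _) hCH)
        (fun y l' => leg_mono (hΦcol (n + 1) y z' l' β) (le_max_left _ _) (min_le_left _ _) (l1_nonneg _) hCΦ)
        (fun k u w y l l' h => table_suppR_mf hL (n + 1) k u w y l l' h)
        (fun k u w y l l' h => table_suppR_fm hL (n + 1) k u w y l l' h)
        (fun k u l l' S T => table_mass2_mf hL (n + 1) k u l l' S T)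
        (fun k u l l' S T => table_mass2_fm hL (n + 1) k u l l' S T)
      rw [ecast] at h2
      -- the prefactor
      have hLp : (0 : ℝ) < ((Lc : ℝ) ^ (n + 1 + 1)) ^ 2 := by positivity
      have hpre : |-(cVH / (Lc : ℝ) ^ (3 + 1)) * ((Lc : ℝ) ^ (n + 1 + 1)) ^ (-(2 : ℤ))| =
          |cVH| / (Lc : ℝ) ^ (3 + 1) * (((Lc : ℝ) ^ (n + 1 + 1)) ^ 2)⁻¹ := by
        rw [zpow_neg, zpow_ofNat, abs_mul, abs_neg, abs_div, abs_of_pos (pow_pos hL0 _), abs_inv, abs_of_pos hLp]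
      -- the support ratio R/N = 8(3+1) is n-free
      have hRN : (4 : ℝ) * (3 + 1 : ℕ) * ((8 * (3 + 1) * Lc ^ (n + 1 + 1) : ℕ) : ℝ) / (Lc : ℝ) ^ (n + 1 + 1) + 2 * (3 + 1 : ℕ) =
          4 * (3 + 1) * (8 * (3 + 1)) + 2 * (3 + 1) := by
        have hN0 : (Lc : ℝ) ^ (n + 1 + 1) ≠ 0 := pow_ne_zero _ hL0.ne'
        push_cast
        field_simp
        norm_num
      rw [hRN] at h2
      have hpow : (((Lc : ℝ) ^ (n + 1 + 1)) ^ 2)⁻¹ * (Lc : ℝ) ^ (n + 1) = ((Lc : ℝ) ^ 2)⁻¹ * ((Lc : ℝ)⁻¹) ^ (n + 1) := by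
        have hL1 : (Lc : ℝ) ≠ 0 := hL0.ne'
        have e2 : ((Lc : ℝ) ^ (n + 1 + 1)) ^ 2 = (Lc : ℝ) ^ 2 * (Lc : ℝ) ^ (n + 1) * (Lc : ℝ) ^ (n + 1) := by ring
        rw [e2, inv_pow, mul_inv, mul_inv, mul_assoc, mul_assoc, inv_mul_cancel₀ (pow_ne_zero _ hL1), mul_one]
      set E := Real.exp (-(κ₁ / 2) * (l1 (x' - u') + l1 (z' - u'))) with hE
      rw [abs_mul, hpre]
      calc |cVH| / (Lc : ℝ) ^ (3 + 1) * (((Lc : ℝ) ^ (n + 1 + 1)) ^ 2)⁻¹ * |_|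
          ≤ |cVH| / (Lc : ℝ) ^ (3 + 1) * (((Lc : ℝ) ^ (n + 1 + 1)) ^ 2)⁻¹ *
              (2 * ((Fintype.card (Fin (3 + 1)) : ℝ) ^ 3 * A ^ 3 * Real.exp (κ₁ * (4 * (3 + 1) * (8 * (3 + 1)) + 2 * (3 + 1))) *
                ((Lc : ℝ) ^ (n + 1) * B₂) * Zl (3 + 1) (κ₁ / 2) * E)) := mul_le_mul_of_nonneg_left h2 (by positivity)
        _ = |cVH| / (Lc : ℝ) ^ (3 + 1) * ((((Lc : ℝ) ^ (n + 1 + 1)) ^ 2)⁻¹ * (Lc : ℝ) ^ (n + 1)) * K * E := by rw [hK]; ring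
        _ = c₀V * ((Lc : ℝ)⁻¹) ^ (n + 1) * E := by rw [hpow, hc₀V]; ring
    · simp only [e3OfS_inl_inr, mul_zero, abs_zero]
      exact hRHS
  · simp only [e3OfS_inr, mul_zero, abs_zero]
    exact hRHS

end Summit.QuantumFields.BalabanUV.Beta.GAN24.S3RowV0

end
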